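import Literature.AlgebraicGeometry.HodgeTheory.SmoothHypersurfaceHodgeBettiNumbers
import Literature.AlgebraicGeometry.HodgeTheory.GriffithsResiduesPoleOrderOneExact
import Literature.RingTheory.HilbertSamuel.PolynomialRing
import HarnessLib

/-!
# `p_g(X_F) ≥ C(d−1, n+1)` for a smooth hypersurface of degree `d` in `ℙⁿ⁺¹` — the proved half of
# `Arapura2012_hypersurface_geometricGenus`

Family `hodge`, layer `Literature/AlgebraicGeometry/HodgeTheory`. PROOF FILE (theorems only; no definition, no
named fact — D-0026), sibling of the statement file `SmoothHypersurfaceHodgeBettiNumbers` (named facts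
`Arapura2012_hypersurface_geometricGenus`: `h^{n,0}(X_F) = C(d−1, n+1)`, and
`EisenbudHarris2016_surface_secondBettiNumber`). Proved here: the monomial count `dim S^{d−n−2} = C(d−1, n+1)`,
the lower bound `C(d−1, n+1) ≤ h^{n,0}(X_F)` (Griffiths' residues at pole order one inject `S^{d−n−2} ↪ H^{n,0}`,
`finrank_homogeneousSubmodule_le_finrank_piece` of `GriffithsResiduesPoleOrderOneExact`), and the repackaging of the
fact as the numerical hypothesis `h^{n,0}(X_F) ≤ dim S^{d−n−2}` consumed by
`finrank_eigenspace_inf_piece_eq_of_finrank_piece_le` (exact equivariant count of `H^{n,0}`).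

## References

* [Arapura2012] D. Arapura, Algebraic Geometry over the Complex Numbers (2012), §17.3 (17.3.1), Cor. 17.3.5.
* [VoisinHodgeII2003] C. Voisin, Hodge Theory and Complex Algebraic Geometry II (2003), §6.1.3 Cor. 6.12.
-/

noncomputable section

open CategoryTheory AlgebraicGeometry MvPolynomial

namespace Literature.AlgebraicGeometry.HodgeTheory

open Literature.AlgebraicGeometry.Motives

section HodgeTheory

/-! ### Proved: the monomial count and the lower bound `C(d−1, n+1) ≤ h^{n,0}` -/

/-- `dim S^{d−n−2} = C(d−1, n+1)` for the forms of degree `d − n − 2` in `n + 2` variables, `d ≥ n + 2`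
(monomial count; the number Arapura's (17.3.1) equates with `h^{0,n}`). [cite: Arapura2012, §17.3 (17.3.1)] -/
theorem finrank_homogeneousSubmodule_sub_eq_choose {n d : ℕ} (hd : n + 2 ≤ d) :
    Module.finrank ℂ ↥(homogeneousSubmodule (Fin (n + 2)) ℂ (d - (n + 2))) = Nat.choose (d - 1) (n + 1) := by
  rw [Literature.RingTheory.HilbertSamuel.finrank_homogeneousSubmodule_fin ℂ (n + 2) (d - (n + 2)),
    show d - (n + 2) + (n + 2) - 1 = d - 1 by omega,
    show d - (n + 2) = (d - 1) - (n + 1) by omega]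
  exact Nat.choose_symm (by omega)

/-- **`C(d−1, n+1) ≤ h^{n,0}(X_F)`** — the proved half of `Arapura2012_hypersurface_geometricGenus`: the
residues `Res(PΩ/F)`, `deg P = d − n − 2`, give `dim S^{d−n−2} = C(d−1, n+1)` independent classes in `H^{n,0}`
(`finrank_homogeneousSubmodule_le_finrank_piece`); for `d < n + 2` the bound is `0`.
[cite: VoisinHodgeII2003, §6.1.3 Cor. 6.12 (p = 1)] [cite: Arapura2012, §17.3 (17.3.1)] -/
theorem choose_le_geometricGenus (hHD : exists_isReal_hodgeModel) {n d : ℕ} (hn : 1 ≤ n)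
    {F : MvPolynomial (Fin (n + 2)) ℂ} (hF : F.IsHomogeneous d) (hJ : SmoothHypersurface.IsNonsingularForm ℂ F)
    (hX : IsSmoothProjective n (SmoothHypersurface.hypersurface F)) :
    Nat.choose (d - 1) (n + 1) ≤ Module.finrank ℂ ↥((BettiUniverse.hodge hHD hX n).piece (n : ℤ) 0) := by
  by_cases hd : n + 2 ≤ d
  · rw [← finrank_homogeneousSubmodule_sub_eq_choose hd]
    exact finrank_homogeneousSubmodule_le_finrank_piece hHD hn hd hF hJ hX
  · rw [Nat.choose_eq_zero_of_lt (by omega)]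
    exact Nat.zero_le _

/-- With the fact: **`h^{n,0}(X_F) ≤ dim S^{d−n−2}`**, the hypothesis `hpg` of
`finrank_eigenspace_inf_piece_eq_of_finrank_piece_le` (so the equivariant count of `H^{n,0}` becomes exact).
[cite: Arapura2012, §17.3 (17.3.1)] [cite: VoisinHodgeII2003, §6.1.3 Cor. 6.12 (p = 1)] -/
theorem finrank_piece_le_finrank_homogeneousSubmodule_of_geometricGenus
    (hA : Arapura2012_hypersurface_geometricGenus) (hHD : exists_isReal_hodgeModel) {n d : ℕ} (hn : 1 ≤ n)
    (hd : n + 2 ≤ d) {F : MvPolynomial (Fin (n + 2)) ℂ} (hF : F.IsHomogeneous d)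
    (hJ : SmoothHypersurface.IsNonsingularForm ℂ F) (hX : IsSmoothProjective n (SmoothHypersurface.hypersurface F)) :
    Module.finrank ℂ ↥((BettiUniverse.hodge hHD hX n).piece (n : ℤ) 0) ≤
      Module.finrank ℂ ↥(homogeneousSubmodule (Fin (n + 2)) ℂ (d - (n + 2))) := by
  rw [finrank_homogeneousSubmodule_sub_eq_choose hd, hA hHD hn (by omega) F hF hJ hX]

end HodgeTheory

end Literature.AlgebraicGeometry.HodgeTheory

end
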